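import Mathlib
import Literature.NumberTheory.Transcendental.DrinfeldAssociator
import Literature.NumberTheory.Transcendental.MZVWordShuffleProofs
import HarnessLib

/-!
# The Drinfeld associator III: group-likeness of `Φ_KZ` from the two algebraic properties of `reg`

Proofs file (theorems only) towards the named fact `drinfeldAssociator_isGroupLike` of
`DrinfeldAssociator.lean` [Drinfeld1991, §2; Furusho2003, Property II (0)]: the series
`Φ_KZ = Σ_W (-1)^{dp W} Z(reg W) W` satisfies the shuffle relations
`c_u c_v = Σ_{w ∈ u ш v} c_w` for ALL binary words `u, v` — the regularised shuffle relations of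
multiple zeta values [IharaKanekoZagier2006, Thm 1–2 (reg_ш form)].

This file is the MZV half of the printed argument [IharaKanekoZagier2006, §1–3], independent of
how the shuffle algebra is modelled:

1. shuffles permute letters, so the sign `(-1)^{dp}` is multiplicative on `u ш v`
   (`MZV.count_of_mem_shuffleWord`);
2. **`Z` is a character of `(𝔥⁰, ш)`** (`MZV.zetaWordSum_shuffleFS`): the shuffle product formula
   for CONVERGENT words `ζ(a) ζ(b) = Σ_{w ∈ a ш b} ζ(w)` is Kontsevich's iterated-integral identity,
   the tree's `multipleZeta_mul_eq_sum_shuffleWord` (`MZVWordShuffleProofs.lean`), extended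
   bilinearly to `𝔥⁰ ⊂ 𝔥 = List Bool →₀ ℚ`;
3. hence, GIVEN the two algebraic properties of IKZ's regularisation `reg = MZV.shuffleReg`
   [IharaKanekoZagier2006, §3 p. 314] — (a) `reg` is a `ш`-homomorphism,
   `Σ_{w ∈ u ш v} reg(w) = reg(u) ш reg(v)`, and (b) `reg` takes values in `𝔥⁰` (no component on
   a non-convergent word) — the functional `W ↦ Z(reg W)` is a character of `(𝔥, ш)`
   (`MZV.zetaWordSum_shuffleReg_mul_of`) and `Φ_KZ` is group-like
   (`drinfeldAssociator_isGroupLike_of_shuffleReg`).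

Properties (a), (b) for the tree's explicit Corollary-5 formula `MZV.shuffleReg` are the content
of `𝔥 = 𝔥⁰[x,y]` [IharaKanekoZagier2006, §2 Prop. 1; Reutenauer1993, §6]; the completed shuffle
algebra with its Taylor constant-term maps proving them is `ShuffleAlgebra.lean`
(`ShuffleAlgebra.reg_mul`, `reg_apply_append_false`, `reg_apply_cons_true`, for its own `reg`),
and the identification of that `reg` with `MZV.shuffleReg` closes `drinfeldAssociator_isGroupLike`
through `drinfeldAssociator_isGroupLike_of_shuffleReg`. No definitions, no named facts here.

## References

* K. Ihara, M. Kaneko, D. Zagier, *Derivation and double shuffle relations for multiple zeta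
  values*, Compos. Math. 142 (2006), 307–338, §1–3, Thm 1, Thm 2. [IharaKanekoZagier2006]
* V. G. Drinfel'd, Leningrad Math. J. 2 (1991), 829–860, §2. [Drinfeld1991]
* H. Furusho, Publ. RIMS 39 (2003), §3.2 (the map `Z`), §3.3 Property II (0). [Furusho2003]
* M. Eie, *The Theory of Multiple Zeta Values with Applications in Combinatorics* (2013), §1.2
  (shuffle product formula). [Eie2013]
-/

noncomputable section

open scoped BigOperators

namespace Literature.NumberTheory.Transcendental

namespace MZV

/-! ## 1. Shuffles permute letters -/

/-- Every interleaving of `u` and `v` is a permutation of `u ++ v`. [folklore] -/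
theorem perm_append_of_mem_shuffleWord {α : Type*} :
    ∀ (u v : List α) {w : List α}, w ∈ shuffleWord u v → w.Perm (u ++ v)
  | [], v, w, hw => by simp_all
  | a :: u, [], w, hw => by simp_all
  | a :: u, b :: v, w, hw => by
    simp only [shuffleWord_cons_cons, List.mem_append, List.mem_map] at hw
    rcases hw with ⟨w', hw', rfl⟩ | ⟨w', hw', rfl⟩
    · exact (perm_append_of_mem_shuffleWord u (b :: v) hw').cons a
    · exact ((perm_append_of_mem_shuffleWord (a :: u) v hw').cons b).trans List.perm_middle.symm

/-- Letter counts add under shuffling: `#_c(w) = #_c(u) + #_c(v)` for `w ∈ u ш v`. [folklore] -/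
theorem count_of_mem_shuffleWord {α : Type*} [DecidableEq α] {u v w : List α}
    (hw : w ∈ shuffleWord u v) (c : α) : w.count c = u.count c + v.count c := by
  rw [(perm_append_of_mem_shuffleWord u v hw).count_eq, List.count_append]

/-! ## 2. `Z` is a character of `(𝔥⁰, ш)` -/

/-- `Z(f + g) = Z(f) + Z(g)`. [cite: Furusho2003, §3.2 (Z is ℚ-linear)] -/
theorem zetaWordSum_add (f g : List Bool →₀ ℚ) :
    zetaWordSum (f + g) = zetaWordSum f + zetaWordSum g :=
  Finsupp.sum_add_index' (by simp) (by intros; simp [add_mul])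

/-- `Z(q • f) = q Z(f)`. [cite: Furusho2003, §3.2 (Z is ℚ-linear)] -/
theorem zetaWordSum_smul (q : ℚ) (f : List Bool →₀ ℚ) :
    zetaWordSum (q • f) = (q : ℝ) * zetaWordSum f := by
  unfold zetaWordSum
  rw [Finsupp.sum_smul_index' (by simp), Finsupp.mul_sum]
  refine Finsupp.sum_congr fun v _ => ?_
  rw [smul_eq_mul, Rat.cast_mul, mul_assoc]

/-- `Z` of a finite sum. [cite: Furusho2003, §3.2] -/
theorem zetaWordSum_finset_sum {ι : Type*} (s : Finset ι) (g : ι → (List Bool →₀ ℚ)) :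
    zetaWordSum (∑ i ∈ s, g i) = ∑ i ∈ s, zetaWordSum (g i) := by
  classical
  induction s using Finset.induction_on with
  | empty => simp
  | insert i s hi ih => rw [Finset.sum_insert hi, Finset.sum_insert hi, zetaWordSum_add, ih]

/-- `Z` of a `Finsupp.sum`. [cite: Furusho2003, §3.2] -/
theorem zetaWordSum_finsupp_sum {β M : Type*} [Zero M] (f : β →₀ M)
    (g : β → M → (List Bool →₀ ℚ)) :
    zetaWordSum (f.sum g) = f.sum fun b m => zetaWordSum (g b m) :=
  zetaWordSum_finset_sum _ _

/-- `Z` of a list sum. [cite: Furusho2003, §3.2] -/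
theorem zetaWordSum_list_sum (l : List (List Bool →₀ ℚ)) :
    zetaWordSum l.sum = (l.map zetaWordSum).sum := by
  induction l with
  | nil => simp
  | cons f l ih => rw [List.sum_cons, zetaWordSum_add, ih, List.map_cons, List.sum_cons]

/-- `Z(Σ_{w ∈ l} w) = Σ_{w ∈ l} ζ(w)`. [cite: Furusho2003, §3.2] -/
theorem zetaWordSum_wordSum (l : List (List Bool)) :
    zetaWordSum (wordSum l) = (l.map fun w => multipleZeta (ofBinaryWord w)).sum := by
  induction l with
  | nil => simp
  | cons w l ih => rw [wordSum_cons, zetaWordSum_add, zetaWordSum_single, ih, List.map_cons,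
      List.sum_cons, Rat.cast_one, one_mul]

/-- `Z(f)` as the finite sum `Σ_{v ∈ supp f} f(v) ζ(v)`. [cite: Furusho2003, §3.2] -/
theorem zetaWordSum_eq_sum_support (f : List Bool →₀ ℚ) :
    zetaWordSum f = ∑ v ∈ f.support, (f v : ℝ) * multipleZeta (ofBinaryWord v) := rfl

/-- A convergent word is the binary word of its (admissible) index. [folklore] -/
theorem binaryWord_ofBinaryWord_of_isConvergentWord {a : List Bool} (h : IsConvergentWord a) :
    binaryWord (ofBinaryWord a) = a := by
  rcases h with rfl | ⟨-, hl⟩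
  · rfl
  · exact binaryWord_ofBinaryWord (by rintro rfl; simp at hl) hl

/-- The index of a convergent word is admissible. [folklore] -/
theorem isAdmissible_ofBinaryWord_of_isConvergentWord {a : List Bool} (h : IsConvergentWord a) :
    IsAdmissible (ofBinaryWord a) := by
  refine isAdmissible_ofBinaryWord ?_
  rcases h with rfl | ⟨hh, -⟩
  · simp
  · rw [hh]; simp

/-- **The shuffle product formula for convergent words** (Kontsevich's iterated integrals):
`ζ(a) ζ(b) = Σ_{w ∈ a ш b} ζ(w)`. [cite: Eie2013, §1.2 (shuffle product formula); IharaKanekoZagier2006, §1] -/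
theorem multipleZeta_ofBinaryWord_mul {a b : List Bool} (ha : IsConvergentWord a)
    (hb : IsConvergentWord b) :
    multipleZeta (ofBinaryWord a) * multipleZeta (ofBinaryWord b) =
      ((shuffleWord a b).map fun w => multipleZeta (ofBinaryWord w)).sum := by
  have h := multipleZeta_mul_eq_sum_shuffleWord (isAdmissible_ofBinaryWord_of_isConvergentWord ha)
    (isAdmissible_ofBinaryWord_of_isConvergentWord hb)
  rwa [binaryWord_ofBinaryWord_of_isConvergentWord ha,
    binaryWord_ofBinaryWord_of_isConvergentWord hb] at h

/-- `Z(a ш b) = ζ(a) ζ(b)` for convergent words. [cite: IharaKanekoZagier2006, §1] -/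
theorem zetaWordSum_shuffleSum {a b : List Bool} (ha : IsConvergentWord a) (hb : IsConvergentWord b) :
    zetaWordSum (shuffleSum a b) = multipleZeta (ofBinaryWord a) * multipleZeta (ofBinaryWord b) := by
  rw [shuffleSum, zetaWordSum_wordSum, multipleZeta_ofBinaryWord_mul ha hb]

/-- **`Z` is a character of `(𝔥⁰, ш)`**: `Z(f ш g) = Z(f) Z(g)` for `f, g ∈ 𝔥` supported on
convergent words. [cite: IharaKanekoZagier2006, §1 (Z : 𝔥⁰ → ℝ is a ш-homomorphism)] -/
theorem zetaWordSum_shuffleFS {f g : List Bool →₀ ℚ} (hf : ∀ w, f w ≠ 0 → IsConvergentWord w)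
    (hg : ∀ w, g w ≠ 0 → IsConvergentWord w) :
    zetaWordSum (shuffleFS f g) = zetaWordSum f * zetaWordSum g := by
  rw [shuffleFS, zetaWordSum_finsupp_sum]
  simp only [zetaWordSum_finsupp_sum, zetaWordSum_smul]
  rw [zetaWordSum_eq_sum_support f, zetaWordSum_eq_sum_support g, Finset.sum_mul_sum, Finsupp.sum]
  refine Finset.sum_congr rfl fun u hu => ?_
  rw [Finsupp.sum]
  refine Finset.sum_congr rfl fun v hv => ?_
  rw [zetaWordSum_shuffleSum (hf u (Finsupp.mem_support_iff.mp hu))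
    (hg v (Finsupp.mem_support_iff.mp hv)), Rat.cast_mul]
  ring

/-! ## 3. `W ↦ Z(reg W)` is a character of `(𝔥, ш)`, given the two algebraic properties of `reg` -/

/-- **The regularised shuffle relations from the algebra of `reg`**: if IKZ's regularisation
`reg = MZV.shuffleReg` is a `ш`-homomorphism (`Σ_{w ∈ u ш v} reg(w) = reg(u) ш reg(v)`) with values
in `𝔥⁰`, then `Z(reg u) Z(reg v) = Σ_{w ∈ u ш v} Z(reg w)` for ALL binary words `u, v`.
[cite: IharaKanekoZagier2006, §3 p. 314 and Thm 1 (reg_ш form)] -/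
theorem zetaWordSum_shuffleReg_mul_of
    (hmul : ∀ u v : List Bool,
      ((shuffleWord u v).map shuffleReg).sum = shuffleFS (shuffleReg u) (shuffleReg v))
    (hconv : ∀ u w : List Bool, shuffleReg u w ≠ 0 → IsConvergentWord w) (u v : List Bool) :
    zetaWordSum (shuffleReg u) * zetaWordSum (shuffleReg v) =
      ((shuffleWord u v).map fun w => zetaWordSum (shuffleReg w)).sum := by
  rw [← zetaWordSum_shuffleFS (hconv u) (hconv v), ← hmul, zetaWordSum_list_sum, List.map_map]
  rfl

end MZV

/-! ## 4. `Φ_KZ` is group-like, given the two algebraic properties of `reg` -/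

/-- **Group-likeness of `Φ_KZ` reduced to the algebra of `reg`**: if `MZV.shuffleReg` is a
`ш`-homomorphism with values in `𝔥⁰` [IharaKanekoZagier2006, §3], then `c_∅(Φ_KZ) = 1` and
`c_u(Φ_KZ) c_v(Φ_KZ) = Σ_{w ∈ u ш v} c_w(Φ_KZ)` for all words `u, v`, i.e.
`drinfeldAssociator_isGroupLike` (the sign `(-1)^{dp}` being multiplicative on shuffles).
[cite: Drinfeld1991, §2; IharaKanekoZagier2006, Thm 1] -/
theorem drinfeldAssociator_isGroupLike_of_shuffleReg
    (hmul : ∀ u v : List Bool,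
      ((MZV.shuffleWord u v).map MZV.shuffleReg).sum =
        MZV.shuffleFS (MZV.shuffleReg u) (MZV.shuffleReg v))
    (hconv : ∀ u w : List Bool, MZV.shuffleReg u w ≠ 0 → MZV.IsConvergentWord w) :
    drinfeldAssociator_isGroupLike := by
  refine ⟨drinfeldAssociator_nil, fun u v => ?_⟩
  rw [drinfeldAssociator_apply, drinfeldAssociator_apply,
    show ∀ a b c d : ℝ, a * b * (c * d) = a * c * (b * d) from fun a b c d => by ring,
    ← pow_add, MZV.zetaWordSum_shuffleReg_mul_of hmul hconv u v, ← List.sum_map_mul_left]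
  refine congrArg List.sum (List.map_congr_left fun w hw => ?_)
  rw [drinfeldAssociator_apply, MZV.count_of_mem_shuffleWord hw]

end Literature.NumberTheory.Transcendental
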